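import Summits.CriticalPhenomena.Ising3DConformalLimit.Theorems.SynchronousCouplingRotationJoiningTiltedTransferDefect
import Summits.CriticalPhenomena.Ising3DConformalLimit.Theorems.SynchronousCouplingRotationJoiningAxis3OfDilationJoinings
import HarnessLib

/-!
# Route `SynchronousCoupling`, crux `RotationJoining` (stmt-CriticalPhenomena-18763), line `SketchIdeator2`
(reshape 2): `stub_tiltedTransfer` — tilted dilation joinings from axis dilation joinings

`TiltedTransfer : TwoPointToolkit → TiltGeometry → BallSums → DilationJoinings → DilationJoiningsTilted`.

Proof. `DilationJoinings` gives `DilationJoiningsAxis3` (`stub_axis3OfDilationJoinings`): couplings `π` of the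
critical state `μ` with itself under which every axis pair `(axisCell (3b') v, axisCell b' v)` of the window has
self-normalised defect `≤ C₀ b'^{-θ₀}`. For a tilted pair `(tiltCell (3b) m u, tiltCell b m u)` read the SAME coupling
at the finer scale `b' = ⌊b^{1-δ}⌋`, `δ = θ₀/(12 + 2θ₀)`, window `2b(m+1)`: by `tiltedTransfer_latticeBound`
(decomposition into fine axis cells plus thin remainders, Cauchy–Schwarz over the `≤ (b/b')³` blocks, renormalisation)
the tilted defect is bounded by lattice ratios which the upper doubling of `TwoPointToolkit` (`V(3L) ≤ A²V(L)`,
`V(n) ≤ A² W(n)` via the axis cube inside the tilted cell) and `BallSums` (`L³ S(2L) ≤ A₂ V(L)`) turn into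
`K · ((b/b')⁶ b'^{-θ₀} + b'/b) ≤ K' b^{-δ}`. Small `b` are absorbed by the product coupling (defect `≤ 56 b³`).
Constants: `θ = δ`, `C = max K (56 B₀⁴)`. No named facts, no definitions.
-/

noncomputable section

namespace Summit.CriticalPhenomena.Ising3DConformalLimit.Cruxes.RotationJoining.RateSplitting

open MeasureTheory Filter Literature.Probability.LatticeModels
open Summit.CriticalPhenomena.Ising3DConformalLimit.Cruxes.ExistsScaleCovariantLimit.MonotoneBlockingPort

/-! ### Crude bounds (small scales, product coupling) -/

/-- `ν(n,m)² ∫ (Σ_{tiltCell n m u} σ)² dμ ≤ n³`: the normalising pair sum is `≥ #cell = n³` and the pair sum of the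
cell at `u` is `≤ (#cell)² = n⁶`. -/
theorem normTilt_sq_mul_integral_le {μ : Measure (SpinConfig (Site 3))} [IsFiniteMeasure μ]
    (hc : ∀ A : Finset (Site 3), spinCorr μ A = plusCorr 3 (criticalBeta 3) 0 A) (hTG : TiltGeometry) {n m : ℕ}
    (hn : 1 ≤ n) {u : Fin 3 → ℤ} (hu : ∀ i, |u i| ≤ m) :
    (normTilt μ n m) ^ 2 * ∫ σ, (blockSum (tiltCell n m u) σ) ^ 2 ∂μ ≤ (n : ℝ) ^ 3 := by
  have h5 := hTG.2.2.2.2.1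
  have h0m : ∀ i, |(0 : Fin 3 → ℤ) i| ≤ (m : ℤ) := fun i => by simp
  have hW : (n : ℝ) ^ 3 ≤ ∑ x ∈ tiltCell n m 0, ∑ y ∈ tiltCell n m 0, criticalTwoPoint 3 (y - x) := by
    have key := card_le_pairSum (tiltCell n m 0)
    rw [h5 n m 0 h0m] at key
    push_cast at key
    exact key
  have hn3 : (0 : ℝ) < (n : ℝ) ^ 3 := by positivity
  have hWpos : 0 < ∑ x ∈ tiltCell n m 0, ∑ y ∈ tiltCell n m 0, criticalTwoPoint 3 (y - x) := lt_of_lt_of_le hn3 hW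
  have hT : ∫ σ, (blockSum (tiltCell n m u) σ) ^ 2 ∂μ ≤ (n : ℝ) ^ 3 * (n : ℝ) ^ 3 := by
    rw [integral_blockSum_sq hc]
    calc ∑ x ∈ tiltCell n m u, ∑ y ∈ tiltCell n m u, criticalTwoPoint 3 (y - x)
        ≤ ((tiltCell n m u).card : ℝ) ^ 2 := pairSum_le_card_sq _
      _ = (n : ℝ) ^ 3 * (n : ℝ) ^ 3 := by
          rw [h5 n m u hu]
          push_cast
          ring
  rw [normTilt, integral_blockSum_sq hc (tiltCell n m 0), inv_pow, Real.sq_sqrt hWpos.le, inv_mul_le_iff₀ hWpos]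
  exact hT.trans (mul_le_mul_of_nonneg_right hW hn3.le)

/-- Crude two-copy bound under the product coupling: the self-normalised tilted defect is `≤ 2 (n₁³ + n₂³)`. -/
theorem crude_defect_bound {μ : Measure (SpinConfig (Site 3))} [IsProbabilityMeasure μ]
    (hc : ∀ A : Finset (Site 3), spinCorr μ A = plusCorr 3 (criticalBeta 3) 0 A) (hTG : TiltGeometry)
    {n₁ n₂ m : ℕ} (hn₁ : 1 ≤ n₁) (hn₂ : 1 ≤ n₂) {u : Fin 3 → ℤ} (hu : ∀ i, |u i| ≤ m) :
    ∫ q, (normTilt μ n₁ m * blockSum (tiltCell n₁ m u) q.1 -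
        normTilt μ n₂ m * blockSum (tiltCell n₂ m u) q.2) ^ 2 ∂(μ.prod μ) ≤
      2 * ((n₁ : ℝ) ^ 3 + (n₂ : ℝ) ^ 3) := by
  have h1 : (μ.prod μ).fst = μ := Measure.fst_prod
  have h2 : (μ.prod μ).snd = μ := Measure.snd_prod
  obtain ⟨B₁, hB₁⟩ := bounded_const_mul_blockSum (normTilt μ n₁ m) (tiltCell n₁ m u)
  obtain ⟨B₂, hB₂⟩ := bounded_const_mul_blockSum (normTilt μ n₂ m) (tiltCell n₂ m u)
  have step := integral_sub_sq_le (μ.prod μ)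
    (f := fun q : SpinConfig (Site 3) × SpinConfig (Site 3) => normTilt μ n₁ m * blockSum (tiltCell n₁ m u) q.1)
    (g := fun q : SpinConfig (Site 3) × SpinConfig (Site 3) => normTilt μ n₂ m * blockSum (tiltCell n₂ m u) q.2)
    ((measurable_const_mul_blockSum _ _).comp measurable_fst)
    ((measurable_const_mul_blockSum _ _).comp measurable_snd) ⟨B₁, fun q => hB₁ q.1⟩ ⟨B₂, fun q => hB₂ q.2⟩
  rw [integral_const_mul_sq, integral_const_mul_sq, integral_sq_comp_fst h1 (measurable_blockSum _),
    integral_sq_comp_snd h2 (measurable_blockSum _)] at step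
  have b1 := normTilt_sq_mul_integral_le hc hTG hn₁ hu
  have b2 := normTilt_sq_mul_integral_le hc hTG hn₂ hu
  linarith

/-! ### Scale bookkeeping: the fine scale `b' = ⌊b^{1-δ}⌋` and the threshold -/

/-- Facts about the fine scale `b' = ⌊b^{1-δ}⌋₊` once `b^{1-δ} ≥ 2L₀` and `3 b^{1-δ} ≤ b`. -/
theorem floor_scale_facts {δ : ℝ} (hδ0 : 0 < δ) (hδ1 : δ < 1) {b L₀ : ℕ} (hL₀ : 1 ≤ L₀)
    (h2 : 2 * (L₀ : ℝ) ≤ (b : ℝ) ^ (1 - δ)) (h3 : 3 * (b : ℝ) ^ (1 - δ) ≤ b) :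
    L₀ ≤ ⌊(b : ℝ) ^ (1 - δ)⌋₊ ∧ 3 * ⌊(b : ℝ) ^ (1 - δ)⌋₊ ≤ b ∧
    ((⌊(b : ℝ) ^ (1 - δ)⌋₊ : ℕ) : ℝ) / b ≤ (b : ℝ) ^ (-δ) ∧
    (b : ℝ) / ⌊(b : ℝ) ^ (1 - δ)⌋₊ ≤ 2 * (b : ℝ) ^ δ ∧
    ∀ θ : ℝ, 0 ≤ θ → ((⌊(b : ℝ) ^ (1 - δ)⌋₊ : ℕ) : ℝ) ^ (-θ) ≤ (2 : ℝ) ^ θ * (b : ℝ) ^ (-((1 - δ) * θ)) := by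
  set x : ℝ := (b : ℝ) ^ (1 - δ) with hx
  have hL₀r : (1 : ℝ) ≤ L₀ := by exact_mod_cast hL₀
  have hx2 : 2 ≤ x := by linarith
  have hxpos : 0 < x := by linarith
  have hbpos : (0 : ℝ) < b := by
    rcases Nat.eq_zero_or_pos b with hb | hb
    · exfalso
      rw [hx, hb, Nat.cast_zero, Real.zero_rpow (by linarith : (0 : ℝ) < 1 - δ).ne'] at hx2
      linarith
    · exact_mod_cast hb
  set n : ℕ := ⌊x⌋₊ with hn
  have hnle : (n : ℝ) ≤ x := Nat.floor_le hxpos.le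
  have hnlt : x < n + 1 := Nat.lt_floor_add_one x
  have hnge : x / 2 ≤ n := by linarith
  have hnpos : (0 : ℝ) < n := by linarith
  have hxb : x / b = (b : ℝ) ^ (-δ) := by
    rw [hx, ← Real.rpow_sub_one hbpos.ne']
    congr 1
    ring
  refine ⟨?_, ?_, ?_, ?_, ?_⟩
  · exact Nat.le_floor (by linarith)
  · have : (3 * n : ℝ) ≤ b := by linarith
    exact_mod_cast this
  · calc (n : ℝ) / b ≤ x / b := by gcongr
      _ = (b : ℝ) ^ (-δ) := hxb
  · have hbx : (b : ℝ) / x = (b : ℝ) ^ δ := by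
      rw [hx, div_eq_iff hxpos.ne', ← Real.rpow_add hbpos]
      ring_nf
      exact (Real.rpow_one _).symm
    calc (b : ℝ) / n ≤ (b : ℝ) / (x / 2) := by gcongr
      _ = 2 * ((b : ℝ) / x) := by ring
      _ = 2 * (b : ℝ) ^ δ := by rw [hbx]
  · intro θ hθ
    calc (n : ℝ) ^ (-θ) ≤ (x / 2) ^ (-θ) :=
          Real.rpow_le_rpow_of_nonpos (by positivity) hnge (by linarith)
      _ = (2 : ℝ) ^ θ * x ^ (-θ) := by
          rw [Real.div_rpow hxpos.le (by norm_num), Real.rpow_neg (by norm_num : (0 : ℝ) ≤ 2), div_eq_mul_inv,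
            inv_inv, mul_comm]
      _ = (2 : ℝ) ^ θ * (b : ℝ) ^ (-((1 - δ) * θ)) := by
          rw [hx, ← Real.rpow_mul hbpos.le]
          congr 2
          ring

/-- Threshold: for `0 < δ < 1` every condition of the form `N ≤ b ∧ c ≤ b^{1-δ} ∧ 3 b^{1-δ} ≤ b` holds for all
large `b` (`b^{1-δ} → ∞`, `b^δ → ∞`). -/
theorem tiltedTransfer_threshold :
    ∀ (δ : ℝ), 0 < δ → δ < 1 → ∀ (N : ℕ) (c : ℝ), ∃ B₀ : ℕ, ∀ b : ℕ, B₀ ≤ b →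
      N ≤ b ∧ c ≤ (b : ℝ) ^ (1 - δ) ∧ 3 * (b : ℝ) ^ (1 - δ) ≤ b := by
  intro δ hδ0 hδ1 N c
  have hT : Tendsto (fun b : ℕ => (b : ℝ) ^ (1 - δ)) atTop atTop :=
    (tendsto_rpow_atTop (by linarith)).comp tendsto_natCast_atTop_atTop
  have hT' : Tendsto (fun b : ℕ => (b : ℝ) ^ δ) atTop atTop :=
    (tendsto_rpow_atTop hδ0).comp tendsto_natCast_atTop_atTop
  have h3 : ∀ᶠ b : ℕ in atTop, 3 * (b : ℝ) ^ (1 - δ) ≤ b := by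
    filter_upwards [hT'.eventually_ge_atTop 3, eventually_ge_atTop 1] with b hb hb1
    have hbpos : (0 : ℝ) < b := by exact_mod_cast hb1
    calc 3 * (b : ℝ) ^ (1 - δ) ≤ (b : ℝ) ^ δ * (b : ℝ) ^ (1 - δ) := by gcongr
      _ = b := by
          rw [← Real.rpow_add hbpos]
          ring_nf
          exact Real.rpow_one _
  obtain ⟨B₀, hB₀⟩ := Filter.eventually_atTop.1 ((eventually_ge_atTop N).and ((hT.eventually_ge_atTop c).and h3))
  exact ⟨B₀, hB₀⟩

/-! ### Real arithmetic of the rate -/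

/-- Ratio facts: the lattice comparisons turn into bounds on the four ratios of the lattice defect bound. -/
private theorem ratio_facts {V₁ V₂ V₃ Vb W₁ W₂ S₆ S₂ Q A' b : ℝ}
    (hW₁ : V₃ ≤ Q * W₁) (hW₂ : Vb ≤ Q * W₂) (hV12 : V₁ ≤ Q * V₂) (hV13 : V₁ ≤ V₃) (hVb3 : Vb ≤ V₃)
    (hS₆ : 27 * b ^ 3 * S₆ ≤ A' * V₃) (hS₂ : b ^ 3 * S₂ ≤ A' * Vb)
    (hW₁p : 0 < W₁) (hW₂p : 0 < W₂) (hV₂p : 0 < V₂) (hV₁0 : 0 ≤ V₁) (hb : 0 < b) (hQ : 0 ≤ Q) (hA' : 0 ≤ A') :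
    V₁ / W₁ ≤ Q ∧ S₆ / W₁ ≤ A' * Q / (27 * b ^ 3) ∧ S₂ * V₁ / (V₂ * W₁) ≤ A' * Q ^ 2 / b ^ 3 ∧
      b ^ 3 * S₂ / W₂ ≤ A' * Q := by
  refine ⟨?_, ?_, ?_, ?_⟩
  · rw [div_le_iff₀ hW₁p]
    linarith
  · rw [div_le_div_iff₀ hW₁p (by positivity)]
    have h := mul_le_mul_of_nonneg_left hW₁ hA'
    linarith
  · rw [div_le_div_iff₀ (by positivity) (by positivity)]
    have h1 : b ^ 3 * S₂ ≤ A' * (Q * W₁) := hS₂.trans (mul_le_mul_of_nonneg_left (hVb3.trans hW₁) hA')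
    have h2 : (b ^ 3 * S₂) * V₁ ≤ (A' * (Q * W₁)) * (Q * V₂) := mul_le_mul h1 hV12 hV₁0 (by positivity)
    linarith
  · rw [div_le_iff₀ hW₂p]
    calc b ^ 3 * S₂ ≤ A' * Vb := hS₂
      _ ≤ A' * (Q * W₂) := mul_le_mul_of_nonneg_left hW₂ hA'
      _ = A' * Q * W₂ := by ring

/-- Final arithmetic: the lattice defect bound with the ratio facts and the scale asymptotics is `≤ K b^{-δ}`. -/
private theorem main_arith {F ρ e s₆ s₂ t Q A' E b b' X : ℝ}
    (hF : F ≤ 6 * (ρ * ((b / b') ^ 6 * e) + 810 * b ^ 2 * b' * s₆ + 30 * b ^ 2 * b' * s₂) * (1 + t))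
    (hρ : ρ ≤ Q) (hs₆ : s₆ ≤ A' * Q / (27 * b ^ 3)) (hs₂ : s₂ ≤ A' * Q ^ 2 / b ^ 3) (ht : t ≤ A' * Q)
    (hE : (b / b') ^ 6 * e ≤ E * X) (hb'b : b' / b ≤ X)
    (he0 : 0 ≤ e) (ht0 : 0 ≤ t) (hQ : 0 ≤ Q) (hA' : 0 ≤ A') (hE0 : 0 ≤ E)
    (hb : 0 < b) (hb' : 0 < b') :
    F ≤ 6 * (1 + A' * Q) * (Q * E + 30 * A' * Q + 30 * A' * Q ^ 2) * X := by
  have hX : 0 ≤ X := le_trans (by positivity) hb'b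
  have h1 : ρ * ((b / b') ^ 6 * e) ≤ Q * (E * X) := mul_le_mul hρ hE (by positivity) hQ
  have h2 : 810 * b ^ 2 * b' * s₆ ≤ 30 * A' * Q * X :=
    calc 810 * b ^ 2 * b' * s₆ ≤ 810 * b ^ 2 * b' * (A' * Q / (27 * b ^ 3)) := by gcongr
      _ = 30 * A' * Q * (b' / b) := by
          field_simp
          ring
      _ ≤ 30 * A' * Q * X := by gcongr
  have h3 : 30 * b ^ 2 * b' * s₂ ≤ 30 * A' * Q ^ 2 * X :=
    calc 30 * b ^ 2 * b' * s₂ ≤ 30 * b ^ 2 * b' * (A' * Q ^ 2 / b ^ 3) := by gcongr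
      _ = 30 * A' * Q ^ 2 * (b' / b) := by field_simp
      _ ≤ 30 * A' * Q ^ 2 * X := by gcongr
  have hS : ρ * ((b / b') ^ 6 * e) + 810 * b ^ 2 * b' * s₆ + 30 * b ^ 2 * b' * s₂ ≤
      Q * (E * X) + 30 * A' * Q * X + 30 * A' * Q ^ 2 * X := by linarith
  have hS0 : 0 ≤ Q * (E * X) + 30 * A' * Q * X + 30 * A' * Q ^ 2 * X := by positivity
  calc F ≤ _ := hF
    _ ≤ 6 * (Q * (E * X) + 30 * A' * Q * X + 30 * A' * Q ^ 2 * X) * (1 + A' * Q) :=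
        mul_le_mul (mul_le_mul_of_nonneg_left hS (by norm_num)) (by linarith) (by linarith) (by linarith)
    _ = 6 * (1 + A' * Q) * (Q * E + 30 * A' * Q + 30 * A' * Q ^ 2) * X := by ring

/-! ### The stub -/

/-- **Registered stub `stub_tiltedTransfer`** of the line `SketchIdeator2` (reshape 2): dilation joinings for TILTED
cells follow from those for axis cells (`DilationJoinings`, item stmt-CriticalPhenomena-18762, through
`stub_axis3OfDilationJoinings`). For `b` large put `b' = ⌊b^{1-δ}⌋`, `δ = θ₀/(12 + 2θ₀)`, and take the axis coupling
at the scales `(3b', b')` with window `2b(m+1)`: a tilted `3b`-cell (copy 1) is the disjoint union of the axis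
`3b'`-cells it contains plus a remainder of `≤ 810 b²b'` points, the tilted `b`-cell (copy 2) that of the axis
`b'`-cells with the same indices plus `≤ 30 b²b'` points (`TiltGeometry`); block by block the coupling defect is
`≤ C₀ b'^{-θ₀}`, Cauchy–Schwarz over the `≤ (b/b')³` blocks, and the remainders and the normaliser mismatch are
controlled by two-point sums (`BallSums`, upper doubling of `TwoPointToolkit`): `tiltedTransfer_latticeBound`. The
result is `≤ K b^{-δ}`; small `b` use the product coupling. -/
theorem stub_tiltedTransfer : Sig.stub_tiltedTransfer := by
  intro hTK hTG hBS hDJ μ hμ hTI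
  obtain ⟨hP, hc⟩ := criticalState_of_mem' hμ
  obtain ⟨C₀, θ₀, hθ₀, hcoup⟩ := stub_axis3OfDilationJoinings hDJ μ hμ hTI
  obtain ⟨L₀, hL₀, A, hA, hdbl, -⟩ := hTK
  obtain ⟨A₂, L₂, hL₂, hball⟩ := hBS 2
  -- constants
  have hQ1 : (1 : ℝ) ≤ A ^ 2 := by nlinarith
  have hQ0 : (0 : ℝ) ≤ A ^ 2 := by positivity
  have hA₂'1 : (1 : ℝ) ≤ max A₂ 1 := le_max_right _ _
  have hA₂'0 : (0 : ℝ) ≤ max A₂ 1 := by positivity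
  have hC₀'0 : (0 : ℝ) < max C₀ 1 := by positivity
  set δ : ℝ := θ₀ / (12 + 2 * θ₀) with hδdef
  have hδ0 : 0 < δ := div_pos hθ₀ (by linarith)
  have hδ1 : δ < 1 := (div_lt_one (by linarith)).2 (by linarith)
  have hδθ : δ ≤ θ₀ / 2 := by
    rw [hδdef, div_le_div_iff₀ (by linarith) (by norm_num)]
    nlinarith
  have hexp : δ * 6 + -((1 - δ) * θ₀) = -(θ₀ / 2) := by
    rw [hδdef]
    field_simp
    ring
  -- lattice comparison facts
  have hV3 : ∀ L : ℕ, L₀ ≤ L → blockCov (3 * L) 0 ≤ A ^ 2 * blockCov L 0 := fun L hL =>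
    calc blockCov (3 * L) 0 ≤ blockCov (2 * (2 * L)) 0 := blockCov_zero_monotone (by omega)
      _ ≤ A * blockCov (2 * L) 0 := hdbl (2 * L) (by omega)
      _ ≤ A * (A * blockCov L 0) := mul_le_mul_of_nonneg_left (hdbl L hL) (by linarith)
      _ = A ^ 2 * blockCov L 0 := by ring
  have hVW : ∀ n m' : ℕ, 3 * L₀ + 6 ≤ n →
      blockCov n 0 ≤ A ^ 2 * ∑ x ∈ tiltCell n m' 0, ∑ y ∈ tiltCell n m' 0, criticalTwoPoint 3 (y - x) := by
    intro n m' hn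
    calc blockCov n 0 ≤ blockCov (2 * (2 * (n / 3))) 0 := blockCov_zero_monotone (by omega)
      _ ≤ A * blockCov (2 * (n / 3)) 0 := hdbl _ (by omega)
      _ ≤ A * (A * blockCov (n / 3) 0) := mul_le_mul_of_nonneg_left (hdbl _ (by omega)) (by linarith)
      _ = A ^ 2 * blockCov (n / 3) 0 := by ring
      _ ≤ A ^ 2 * ∑ x ∈ tiltCell n m' 0, ∑ y ∈ tiltCell n m' 0, criticalTwoPoint 3 (y - x) :=
          mul_le_mul_of_nonneg_left (blockCov_third_le_pairSum_tiltCell hTG n m') hQ0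
  have hball' : ∀ L : ℕ, L₂ ≤ L →
      (L : ℝ) ^ 3 * ∑ z ∈ box 3 (2 * L), criticalTwoPoint 3 z ≤ max A₂ 1 * blockCov L 0 := fun L hL =>
    (hball L hL).trans (mul_le_mul_of_nonneg_right (le_max_left _ _) (blockCov_zero_pos L (by omega)).le)
  -- threshold and constants
  obtain ⟨B₀, hB₀⟩ := tiltedTransfer_threshold δ hδ0 hδ1 (3 * L₀ + 6 + L₂) (2 * L₀)
  set E : ℝ := 64 * (2 : ℝ) ^ θ₀ * max C₀ 1 with hEdef
  have hE0 : 0 ≤ E := by positivity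
  set K : ℝ := 6 * (1 + max A₂ 1 * A ^ 2) * (A ^ 2 * E + 30 * max A₂ 1 * A ^ 2 + 30 * max A₂ 1 * (A ^ 2) ^ 2)
    with hKdef
  refine ⟨max K (56 * (B₀ : ℝ) ^ 4), δ, hδ0, fun b m hb => ?_⟩
  have hbpos : (0 : ℝ) < b := by exact_mod_cast hb
  have hb1 : (1 : ℝ) ≤ b := by exact_mod_cast hb
  have hbδ : 0 < (b : ℝ) ^ (-δ) := Real.rpow_pos_of_pos hbpos _
  rcases le_or_gt B₀ b with hbB | hbB
  · -- large scales: the axis coupling at the fine scales `(3b', b')`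
    obtain ⟨hbN, hb2, hb3⟩ := hB₀ b hbB
    obtain ⟨hL₀b', h3b', hb'b, hbb', hb'θ⟩ := floor_scale_facts hδ0 hδ1 hL₀ hb2 hb3
    set b' : ℕ := ⌊(b : ℝ) ^ (1 - δ)⌋₊ with hb'def
    have hb'1 : 1 ≤ b' := le_trans hL₀ hL₀b'
    have hb'pos : (0 : ℝ) < b' := by exact_mod_cast hb'1
    obtain ⟨π, hπ1, hπ2, hπ3⟩ := hcoup b' (2 * b * (m + 1)) hb'1
    refine ⟨π, hπ1, hπ2, fun u hu => ?_⟩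
    -- per-block bound at the fine scales
    have he : ∀ v : Fin 3 → ℤ, (∀ i, |v i| ≤ 2 * (b : ℤ) * ((m : ℤ) + 1)) →
        ∫ q, (normAxis μ (3 * b') * blockSum (axisCell (3 * b') v) q.1 -
          normAxis μ b' * blockSum (axisCell b' v) q.2) ^ 2 ∂π ≤ max C₀ 1 * (b' : ℝ) ^ (-θ₀) := by
      intro v hv
      have hv' : ∀ i, |v i| ≤ ((2 * b * (m + 1) : ℕ) : ℤ) := fun i => by push_cast; exact hv i
      exact (hπ3 v hv').trans (mul_le_mul_of_nonneg_right (le_max_left _ _) (Real.rpow_nonneg hb'pos.le _))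
    have hLB := tiltedTransfer_latticeBound μ hμ hTG π hπ1 hπ2 b b' m u (max C₀ 1 * (b' : ℝ) ^ (-θ₀)) hb'1 h3b' hu
      (by positivity) he
    -- ratio facts
    have hW₁p : 0 < ∑ x ∈ tiltCell (3 * b) m 0, ∑ y ∈ tiltCell (3 * b) m 0, criticalTwoPoint 3 (y - x) :=
      pairSum_tiltCell_pos hTG (by omega) m
    have hW₂p : 0 < ∑ x ∈ tiltCell b m 0, ∑ y ∈ tiltCell b m 0, criticalTwoPoint 3 (y - x) :=
      pairSum_tiltCell_pos hTG (by omega) m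
    have hS₆ : 27 * (b : ℝ) ^ 3 * ∑ z ∈ box 3 (2 * (3 * b)), criticalTwoPoint 3 z ≤ max A₂ 1 * blockCov (3 * b) 0 := by
      have key := hball' (3 * b) (by omega)
      push_cast at key
      linarith
    obtain ⟨r1, r2, r3, r4⟩ := ratio_facts (hVW (3 * b) m (by omega)) (hVW b m (by omega)) (hV3 b' hL₀b')
      (blockCov_zero_monotone (show 3 * b' ≤ 3 * b by omega)) (blockCov_zero_monotone (show b ≤ 3 * b by omega))
      hS₆ (hball' b (by omega)) hW₁p hW₂p (blockCov_zero_pos b' hb'1) (blockCov_zero_pos _ (by omega)).le hbpos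
      hQ0 hA₂'0
    -- scale asymptotics
    have hEX : ((b : ℝ) / b') ^ 6 * (max C₀ 1 * (b' : ℝ) ^ (-θ₀)) ≤ E * (b : ℝ) ^ (-δ) := by
      have hbexp : ((b : ℝ) ^ δ) ^ 6 * (b : ℝ) ^ (-((1 - δ) * θ₀)) ≤ (b : ℝ) ^ (-δ) := by
        rw [← Real.rpow_natCast, ← Real.rpow_mul hbpos.le, ← Real.rpow_add hbpos]
        refine Real.rpow_le_rpow_of_exponent_le hb1 ?_
        push_cast
        linarith
      calc ((b : ℝ) / b') ^ 6 * (max C₀ 1 * (b' : ℝ) ^ (-θ₀))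
          ≤ (2 * (b : ℝ) ^ δ) ^ 6 * (max C₀ 1 * ((2 : ℝ) ^ θ₀ * (b : ℝ) ^ (-((1 - δ) * θ₀)))) := by
            gcongr
            exact hb'θ θ₀ hθ₀.le
        _ = E * (((b : ℝ) ^ δ) ^ 6 * (b : ℝ) ^ (-((1 - δ) * θ₀))) := by
            rw [hEdef]
            ring
        _ ≤ E * (b : ℝ) ^ (-δ) := mul_le_mul_of_nonneg_left hbexp hE0
    have hS₂0 : 0 ≤ ∑ z ∈ box 3 (2 * b), criticalTwoPoint 3 z := Finset.sum_nonneg fun _ _ => criticalTwoPoint_nonneg' _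
    have hV₂p : 0 < blockCov b' 0 := blockCov_zero_pos b' hb'1
    have hV₁p : 0 < blockCov (3 * b') 0 := blockCov_zero_pos _ (by omega)
    calc _ ≤ _ := hLB
      _ ≤ K * (b : ℝ) ^ (-δ) :=
          main_arith le_rfl r1 r2 r3 r4 hEX hb'b (by positivity)
            (div_nonneg (mul_nonneg (pow_nonneg hbpos.le 3) hS₂0) hW₂p.le) hQ0 hA₂'0 hE0 hbpos hb'pos
      _ ≤ max K (56 * (B₀ : ℝ) ^ 4) * (b : ℝ) ^ (-δ) := by
          gcongr
          exact le_max_left _ _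
  · -- small scales: the product coupling
    haveI := hP
    refine ⟨μ.prod μ, Measure.fst_prod, Measure.snd_prod, fun u hu => ?_⟩
    have hB₀b : (b : ℝ) ≤ B₀ := by exact_mod_cast hbB.le
    have hcrude := crude_defect_bound hc hTG (show 1 ≤ 3 * b by omega) hb hu
    have hinv : (b : ℝ)⁻¹ ≤ (b : ℝ) ^ (-δ) := by
      rw [← Real.rpow_neg_one]
      exact Real.rpow_le_rpow_of_exponent_le hb1 (by linarith)
    calc _ ≤ 2 * (((3 * b : ℕ) : ℝ) ^ 3 + (b : ℝ) ^ 3) := hcrude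
      _ = 56 * (b : ℝ) ^ 4 * (b : ℝ)⁻¹ := by
          push_cast
          field_simp
          ring
      _ ≤ 56 * (B₀ : ℝ) ^ 4 * (b : ℝ) ^ (-δ) := by gcongr
      _ ≤ max K (56 * (B₀ : ℝ) ^ 4) * (b : ℝ) ^ (-δ) := by
          gcongr
          exact le_max_right _ _

end Summit.CriticalPhenomena.Ising3DConformalLimit.Cruxes.RotationJoining.RateSplitting

end
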